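import Mathlib
import Summits.CriticalPhenomena.Ising3DConformalLimit.Theses.HyperoctahedralRP
import Summits.CriticalPhenomena.Ising3DConformalLimit.Theorems.HRP2Rigidity.Negative.LoadBearing
import Summits.CriticalPhenomena.Ising3DConformalLimit.Theorems.HRP2Rigidity.Negative.Descent
import Literature.MathematicalPhysics.QuantumFieldTheory.LatticeMirrorNormals
import Literature.MathematicalPhysics.QuantumFieldTheory.MirrorRPKernel

/-!
# Line `wall-jump-edge-of-the-wedge` — skeleton for the crux `HyperoctahedralRP.HRP2Rigidity`
(crux item stmt-CriticalPhenomena-1979, rank 2, route `route-CriticalPhenomena-HyperoctahedralRP`;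
crux-plan gen 2, 2026-08-16 — supersedes the gen-1 skeleton of the same line: the wall sweep is now CUT
into a typed microlocal statement (S4a), a typed OPEN CORE (S4) and an elementary sweep lemma (S4c), every
stub is stated over EXISTING declarations only (Mathlib + `latticeMirrorNormals` + `IsMirrorRPKernel`; no
line-local vocabulary in any stub signature), and the file is elaborated next to the landed
`Theorems/HRP2Rigidity/Negative/{LoadBearing,Descent}.lean`.)

Crux (FIXED, by name): `HRP2Rigidity` — a continuous positive kernel `K` on `ℝ³∖{0}`, homogeneous of
degree `-2Δ`, `1/2 ≤ Δ ≤ 1`, invariant AND reflection positive w.r.t. the nine `B₃` lattice mirror normals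
`e_i, e_i ± e_j` (`latticeMirrorNormals (Fin 3)`), is `O(3)`-invariant.

DICTIONARY (Disproof F1, all triagers). `a = 3/2 - Δ ∈ [1/2, 1]`, `K̂(k) = |k|^{-2a} C(k̂)` with `C` the
angular profile (below: a `0`-homogeneous function on `ℝ³`). For a normal `n` (unit `n̂ = n/‖n‖`) and a
unit `u ⊥ n` the LEAF of fan `n` through `u` is the great circle `ψ ↦ cos ψ u + sin ψ n̂`; a LEAF PROFILE is a
`G : ℂ → ℂ` with `G (cos 2ψ) = C (cos ψ u + sin ψ n̂)` for all real `ψ` (coordinate `w = cos 2ψ`). RP_n ⟺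
Stieltjes pencils ⟺ `G` holomorphic on `{Im w ≠ 0} ∪ {|Re w| < 1 + δ}` with `(1+w)^a G` PICK. The slit
`[1+δ,∞)` is the EQUATORIAL (de Sitter) wall of fan `n` (jump = spacelike Källén–Lehmann density), the slit
`(-∞,-1-δ]` the POLAR wall (jump = deviation of the timelike phase from its round value).
WALL COORDINATES of fan `n` with an orthonormal basis `(b₁, b₂)` of `n^⊥`: `(w₀, φ) ∈ ℝ × ℝ`, `|w₀| > 1`
(`w₀ = ± cosh 2η`, `η` = rapidity), leaf direction `u(φ) = cos φ b₁ + sin φ b₂`.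
JUMP-FREE at `(w₀, φ)` :⟺ `∃ ε > 0, ∀ (w', φ')` `ε`-close, the leaf profile through `u(φ')` is holomorphic
on `{Im ≠ 0} ∪ {|Re| < 1} ∪ B(w', ε)` (locally uniform continuation across the real axis).
WALL-SINGULAR SET `F := {(w₀, φ) | ¬ jump-free}` — closed, `2π`-periodic, `⊂ {|w₀| ≥ 1 + δ/2}`; it is the
support of the wall-jump distribution (equatorial part `w₀ > 1`, polar part `w₀ < -1`).
NORMAL-CONE CONDITION with aperture `c`: for `p ∈ F` and `f` differentiable at `p` with a local maximum ON `F`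
at `p` (an exterior normal `(α, β) = (∂_{w₀} f, ∂_φ f)`, Hörmander Def. 8.5.7 / Prop. 8.5.8):
`c(w₀) |β| ≤ |α|` — the typed shadow of `N̄(F) ⊂ WF_A(jump) ⊂ {|α| ≥ c|β|}`.

THE LINE (card `Ideas/wall-jump-edge-of-the-wedge.md`, triage r1-1/2/3: pass) — kill `F` for ONE fan:
* `stub_laplaceRepresentation` (S1, x-space dictionary; BCR Thm 4.2.8/§4.4, M–L) — mirror-RP + homogeneity +
  continuity ⇒ `K = ∫ e^{-λ⟨x,n̂⟩} cos⟨ξ,x⟩ dμ_n(λ,ξ)` on the open half-space, `μ_n ≥ 0`. RP is consumed HERE.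
* `stub_analyticProfile` (S2, k-space dictionary + the route's LOCAL step, L–XL) — the nine Laplace measures
  ⇒ a `0`-homogeneous REAL-ANALYTIC nine-invariant profile `C` with a UNIFORM slit margin `δ > 0` and Pick
  leaf profiles on all nine fans, `K̂ = |k|^{-2a} C` weakly, and the transfer `C ∘ R = C ⇒ K ∘ R = K`.
* `stub_bipolarSeeds` (S3, the 7-circle lemma made OPEN, M–L) — for an oblique lattice partner `m` of `n`
  the whole vertical wall line over the bi-polar direction `unit(m - ⟨m,n⟩n/‖n‖²)` is jump-free at every
  height (cross theorem on fan `m`): the SEEDS.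
* `stub_wallNormalCone` (S4a, Martineau boundary values + Hörmander 8.5.6′; theorem-shaped, XL) — `F` obeys
  the normal-cone condition for SOME continuous aperture `c > 0` (no conormal in the pure leaf direction).
  With this alone the sweep clears only cusps of finite width around the seed lines (pay-off (4a)).
* `stub_apertureUpgrade` (S4, HARDEST — the card's OPEN CORE (4b); crux-strength given the rest) — the
  aperture can be taken with NON-INTEGRABLE tails (`c(w₀) ≍ 1/|w₀|` = height-uniform in rapidity = what
  asymptotic dilation covariance at infinity of the quadric, the card's bet, gives: exactly log-divergent).
* `stub_holmgrenJohnSweep` (S4c, John's global Holmgren sweep in the wall geometry; elementary, M) — a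
  closed `2π`-periodic `F ⊂ {|w₀| > w₁}` with the normal-cone condition for a non-integrable aperture that
  misses ONE vertical line is empty.
* `stub_jumpFreeFanConstant` (S5, transfer `C⁺_wall(n) ⇒ crux`, M–L) — `F = ∅` + Pick ⇒ every leaf profile
  of fan `n` is entire of Pick growth ⇒ constant ⇒ `C ≡ C(n)` off `0`.
* `HRP2Rigidity_of : HRP2Rigidity` — kernel-checked composition at `n = e₃`, basis `(e₁, e₂)`, seed partner
  `m = e₁ + e₃` (bi-polar direction `e₁ = u(0)`): evenness (landed `Negative.even_of_coordinate_mirrors`) →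
  S1 ×9 → S2 → S3 (the line `φ = 0`) → S4a → S4 → [`F` closed, periodic, `F ⊂ {|w₀| > 1}`: proved below]
  S4c ⇒ `F = ∅` → S5 → transfer.

Disproof.lean (gen 2, cycle 2) and the LANDED Negative lemmas honoured (imported above):
`Negative.hrp2Rigidity_false_without_RP` (LOAD-BEARING: RP must be used) — RP is the hypothesis
`IsMirrorRPKernel n K` of S1, invoked nine times in `HRP2Rigidity_of`, and survives downstream as the Pick
clause (S2 output; S4a/S4/S5 input); the quartic witness `(Σxᵢ⁴)/(Σxᵢ²)³` is nine-invariant but its leaves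
are not Pick, so it meets no stub's hypotheses. `Negative.footpoint_bound`/`rp_two_point` ("`m ≤ 2` decides
nothing") — S1 consumes all finite configurations. `Negative.hrp2Rigidity_descent` (Δ-monotonicity, weakest
point `Δ = 1`) and Disproof F11 (no leafwise maximum principle for `a < 1`) — respected: no stub uses a sign
or a maximum principle; S4a/S4 carry `1/2 ≤ a ≤ 1`, S5 only `0 < a ≤ 1`. `Negative.leafPhi_antitone` /
`leaf_round_of_Phi_eq` (F9, the `a = 1` GLOBAL step) close the crux at `Δ = 1/2` from S2's output alone — a
by-product the lead may land first; this line is uniform in `a` and uses them nowhere. F3 (the nine leafwise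
conditions interact only through `C|S²`) = the typed interface of S3–S5; F7's forbidden vertical wall lines =
S3's seed lines; F12: an `H ∈ V_R ∖ ℝ` would give a polar-side `F` with integrable aperture — it would kill S4
(and the crux on `(1/2,1]`), consistent. No stub is an instance of a refuted statement (`ledger negatives`:
8 items, none on two-point kernels); no `-- Targets` kill in Disproof.lean concerns this line.
-/

noncomputable section

namespace Summit.CriticalPhenomena.Ising3DConformalLimit.Cruxes.HRP2Rigidity.WallJumpEdgeOfTheWedge

open scoped BigOperators InnerProductSpace FourierTransform SchwartzMap
open MeasureTheory Filter
open Literature.MathematicalPhysics.QuantumFieldTheory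
open Summit.CriticalPhenomena.Ising3DConformalLimit.Theses.HyperoctahedralRP

set_option linter.unusedVariables false

/-- `ℝ³` (reducible abbreviation; unfolds in every registered signature). -/
abbrev E3 := EuclideanSpace ℝ (Fin 3)

/-! ## S1 — the Laplace–Fourier (Källén–Lehmann) representation of a mirror-RP homogeneous kernel -/

/-- **S1 `stub_laplaceRepresentation`** (x-space dictionary; Berg–Christensen–Ressel Thm 4.2.8 and §4.4,
Glimm–Jaffe Thm 6.2.4 without Euclidean invariance). A kernel `K` on `ℝ³`, continuous off `0`,
homogeneous of degree `-2Δ ≤ 0`, even, invariant under the mirror `θ_n` and reflection positive w.r.t. the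
mirror normal `n ≠ 0` (all finite configurations in the open half-space), is on the open half-space
`⟨x,n⟩ > 0` the Laplace–Fourier transform of a positive measure `μ` on `[0,∞) × n^⊥`:
`K x = ∫ e^{-λ ⟨x,n⟩/‖n‖} cos ⟨ξ, x⟩ dμ(λ, ξ)`. Why true: RP_n = positive-definiteness on the `*`-semigroup
(open half-space, `+`, `s* = -θ_n s`); `K(· + t₀ n̂)` is bounded (non-positive degree + continuity on the
sphere) and continuous on the closed half-space semigroup with identity ⇒ BCR 4.2.8/4.4 integral over
bounded semicharacters `e^{-λt} e^{i⟨ξ,y⟩}`, unique ⇒ consistent in `t₀`; reality/evenness ⇒ cosine.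
RP is consumed here (`Negative.hrp2Rigidity_false_without_RP`: it must be). Size M–L (vendor BCR 4.2.8 as a
named Literature fact — announced as "NOT here" in `MirrorRPKernel.lean` — or prove it). Same statement as
the gen-1 skeleton; shared with line laplace-lightcone-bootstrap's `stub_laplaceRep` up to packaging. -/
theorem stub_laplaceRepresentation :
    ∀ (Δ : ℝ) (K : E3 → ℝ) (n : E3), 0 ≤ Δ → n ≠ 0 →
      ContinuousOn K {0}ᶜ →
      (∀ c : ℝ, 0 < c → ∀ x, K (c • x) = c ^ (-(2 * Δ)) * K x) →
      (∀ x, K (-x) = K x) →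
      (∀ x, K (((ℝ ∙ n)ᗮ).reflection x) = K x) →
      IsMirrorRPKernel n K →
      ∃ μ : Measure (ℝ × E3),
        (∀ᵐ p ∂μ, 0 ≤ p.1 ∧ inner ℝ p.2 n = 0) ∧
        ∀ x : E3, 0 < inner ℝ x n →
          Integrable (fun p : ℝ × E3 => Real.exp (-(p.1 * (inner ℝ x n / ‖n‖)))) μ ∧
          K x = ∫ p, Real.exp (-(p.1 * (inner ℝ x n / ‖n‖))) * Real.cos (inner ℝ p.2 x) ∂μ := by
  sorry

/-! ## S2 — k-space dictionary + LOCAL step: the analytic angular profile with Pick leaf profiles -/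

/-- **S2 `stub_analyticProfile`** (k-space dictionary and the route's LOCAL step). Let `K` be continuous
and positive off `0`, homogeneous of degree `-2Δ` with `1/2 ≤ Δ ≤ 1`, invariant under the nine lattice
mirrors, and represented on each of the nine open half-spaces by a Laplace–Fourier measure as in S1. Then
there is `C : ℝ³ → ℝ` (the angular profile, `K̂ = |k|^{-2a} C`, `a = 3/2 - Δ`) with:
(P1) `C (c • k) = C k`; (P2) `C` REAL-ANALYTIC on `ℝ³∖0` — the LOCAL step: `K̂` extends holomorphically (as
a measure-valued function) in `k_n` on `Re k_n ≠ 0` along every normal `n` not orthogonal to `k` (from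
`2λ/(λ²+k_n²)`), those normals span (`span_latticeMirrorNormals_inner_ne_zero`), so `WF_A(K̂) = ∅` off `0`;
equivalently the Bernstein–Siciak cross theorem in a gnomonic chart (triage r1-1); (P6) nine-mirror
invariance; (P4u) ONE margin `δ > 0` such that for every lattice normal `n` and unit `u ⊥ n` there is a leaf
profile `G`, holomorphic on `{Im w ≠ 0} ∪ {|Re w| < 1 + δ}`, with `G (cos 2ψ) = C (cos ψ u + sin ψ n̂)` and
`(1+w)^{3/2-Δ} G` Pick on the upper half-plane (F1: `s ↦ K̂(√s n̂ + u)` is Stieltjes by Fourier-transforming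
S1; `w = (1-s)/(1+s)`, `(1+w)^a G = 2^a f`; the margin at `w = ±1` from (P2) at `u` and at the pole `n̂` via
evenness in `ψ` (`θ_n`) and about `π/2` (`-θ_n`); UNIFORMITY of `δ` by compactness of `S²` and local
uniformity of analyticity radii); (P8) `K̂ = |k|^{-2a} C` weakly against Schwartz functions (`K`,
`|k|^{-2a}` locally integrable tempered; no part at `0`: degree `-2a > -3`); (P5) TRANSFER: `C ∘ R = C` for a
linear isometry `R` ⇒ `K ∘ R = K` (`𝓕 ∘ R = R ∘ 𝓕`, injectivity on `𝒮'`, continuity off `0`, `K 0 = 0`).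
Why it might fail: only through (P2) — a priori the angular part of `K̂` is a measure on `S²` (triage r1-3).
Size L–XL (homogeneous tempered Fourier analysis is thin in Mathlib; the cross theorem is not in tree). -/
theorem stub_analyticProfile :
    ∀ (Δ : ℝ) (K : E3 → ℝ), 1/2 ≤ Δ → Δ ≤ 1 → ContinuousOn K {0}ᶜ → (∀ x, x ≠ 0 → 0 < K x) →
      (∀ c : ℝ, 0 < c → ∀ x, K (c • x) = c ^ (-(2 * Δ)) * K x) →
      (∀ n ∈ latticeMirrorNormals (Fin 3), ∀ x, K (((ℝ ∙ n)ᗮ).reflection x) = K x) →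
      (∀ n ∈ latticeMirrorNormals (Fin 3), ∃ μ : Measure (ℝ × E3),
        (∀ᵐ p ∂μ, 0 ≤ p.1 ∧ inner ℝ p.2 n = 0) ∧
        ∀ x : E3, 0 < inner ℝ x n →
          Integrable (fun p : ℝ × E3 => Real.exp (-(p.1 * (inner ℝ x n / ‖n‖)))) μ ∧
          K x = ∫ p, Real.exp (-(p.1 * (inner ℝ x n / ‖n‖))) * Real.cos (inner ℝ p.2 x) ∂μ) →
      ∃ C : E3 → ℝ,
        (∀ c : ℝ, 0 < c → ∀ k, C (c • k) = C k) ∧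
        AnalyticOnNhd ℝ C {0}ᶜ ∧
        (∀ n ∈ latticeMirrorNormals (Fin 3), ∀ k, C (((ℝ ∙ n)ᗮ).reflection k) = C k) ∧
        (∃ δ : ℝ, 0 < δ ∧ ∀ n ∈ latticeMirrorNormals (Fin 3), ∀ u : E3, inner ℝ u n = 0 → ‖u‖ = 1 →
          ∃ G : ℂ → ℂ, DifferentiableOn ℂ G {w : ℂ | w.im ≠ 0 ∨ |w.re| < 1 + δ} ∧
            (∀ ψ : ℝ, G (Real.cos (2 * ψ) : ℂ) =
              (C (Real.cos ψ • u + Real.sin ψ • (‖n‖⁻¹ • n)) : ℂ)) ∧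
            (∀ w : ℂ, 0 < w.im → 0 ≤ ((1 + w) ^ (((3:ℝ)/2 - Δ : ℝ) : ℂ) * G w).im)) ∧
        (∀ φ : 𝓢(E3, ℂ), ∫ x, (K x : ℂ) * 𝓕 (⇑φ) x =
          ∫ k, ((‖k‖ ^ (-(2 * ((3:ℝ)/2 - Δ))) * C k : ℝ) : ℂ) * φ k) ∧
        (∀ R : E3 ≃ₗᵢ[ℝ] E3, (∀ k, C (R k) = C k) → ∀ x, K (R x) = K x) := by
  sorry

/-! ## S3 — SEEDS: the wall of fan `n` is jump-free over the bi-polar direction of an oblique partner -/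

/-- **S3 `stub_bipolarSeeds`** (the 7-circle lemma made OPEN; card step (ii)). Let `n, m` be lattice
normals, neither orthogonal nor parallel, `(b₁, b₂)` an orthonormal pair in `n^⊥`, `C` `0`-homogeneous and
real-analytic off `0`, and suppose the leaf profiles of fans `n` and `m` are slit-holomorphic with margin
`δ` (Pick not needed). If `cos φ₀ b₁ + sin φ₀ b₂` is the bi-polar direction `unit(m - ⟨m,n⟩n/‖n‖²)`, then the
wall of fan `n` is JUMP-FREE at `(w₀, φ₀)` for EVERY `w₀` (both walls, all heights, locally uniformly in
`(w', φ')`). Why true: the complexified leaf of fan `n` through the bi-polar direction is `span_ℂ(n,m) ∩ Q`,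
also a leaf of fan `m`, on which fan `n`'s wall points `Re ψ ∈ (π/2)ℤ` sit at fan-`m` parameters
`Re ψ' ∈ γ + (π/2)ℤ`, `γ = ∠(n̂, m̂) ∉ (π/2)ℤ` — interior points of fan `m`'s slit domain (Disproof F3: books
meet only on bipolar leaves; oblique ⇒ the wall sets interleave); the two continuations of `C` agree on the
connected common domain containing the real circle; the cross theorem (Siciak: separately holomorphic in
`ψ'` on the slit domain for each real leaf angle, jointly real-analytic near `S²` by real-analyticity of `C`)
thickens fan `m` to an OPEN subset of `Q_ℂ` containing any compact piece of the bipolar leaf off fan `m`'s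
walls, hence the paths `ψ ∈ [±ε] + i[0, η+1]` of the leaves through `cos φ' b₁ + sin φ' b₂`, `φ'` near
`φ₀`, uniformly; `w = cos 2ψ` is locally biholomorphic at `ψ = iη, π/2 + iη` (`η ≠ 0`), and `|w₀| < 1 + δ`
is covered by the margin. Size M–L (a cross theorem with one real factor is not in Mathlib; the rest is
one-variable: identity theorem, `AnalyticOnNhd.eqOn_of_preconnected_of_frequently_eq`). -/
theorem stub_bipolarSeeds :
    ∀ (C : E3 → ℝ) (n m b₁ b₂ : E3) (δ φ₀ : ℝ),
      n ∈ latticeMirrorNormals (Fin 3) → m ∈ latticeMirrorNormals (Fin 3) →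
      inner ℝ n m ≠ 0 → inner ℝ n m ^ 2 ≠ ‖n‖ ^ 2 * ‖m‖ ^ 2 →
      ‖b₁‖ = 1 → ‖b₂‖ = 1 → inner ℝ b₁ b₂ = 0 → inner ℝ b₁ n = 0 → inner ℝ b₂ n = 0 →
      (∀ c : ℝ, 0 < c → ∀ k, C (c • k) = C k) → AnalyticOnNhd ℝ C {0}ᶜ → 0 < δ →
      (∀ u : E3, inner ℝ u n = 0 → ‖u‖ = 1 → ∃ G : ℂ → ℂ,
        DifferentiableOn ℂ G {w : ℂ | w.im ≠ 0 ∨ |w.re| < 1 + δ} ∧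
        ∀ ψ : ℝ, G (Real.cos (2 * ψ) : ℂ) = (C (Real.cos ψ • u + Real.sin ψ • (‖n‖⁻¹ • n)) : ℂ)) →
      (∀ u : E3, inner ℝ u m = 0 → ‖u‖ = 1 → ∃ G : ℂ → ℂ,
        DifferentiableOn ℂ G {w : ℂ | w.im ≠ 0 ∨ |w.re| < 1 + δ} ∧
        ∀ ψ : ℝ, G (Real.cos (2 * ψ) : ℂ) = (C (Real.cos ψ • u + Real.sin ψ • (‖m‖⁻¹ • m)) : ℂ)) →
      Real.cos φ₀ • b₁ + Real.sin φ₀ • b₂ =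
        ‖m - (inner ℝ m n / ‖n‖ ^ 2) • n‖⁻¹ • (m - (inner ℝ m n / ‖n‖ ^ 2) • n) →
      ∀ w₀ : ℝ, ∃ ε : ℝ, 0 < ε ∧ ∀ w' φ' : ℝ, |w' - w₀| < ε → |φ' - φ₀| < ε →
        ∃ G : ℂ → ℂ, DifferentiableOn ℂ G ({w : ℂ | w.im ≠ 0 ∨ |w.re| < 1} ∪ Metric.ball (w' : ℂ) ε) ∧
          ∀ ψ : ℝ, G (Real.cos (2 * ψ) : ℂ) =
            (C (Real.cos ψ • (Real.cos φ' • b₁ + Real.sin φ' • b₂) + Real.sin ψ • (‖n‖⁻¹ • n)) : ℂ) := by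
  sorry

/-! ## S4a — the microlocal theorem: exterior normals of the wall-singular set avoid the leaf direction -/

/-- **S4a `stub_wallNormalCone`** (Martineau/Hörmander boundary values + `N̄(supp u) ⊂ WF_A(u)`; the card's
lever, theorem-shaped). For `1/2 ≤ a ≤ 1`, a lattice normal `n` with an orthonormal pair `(b₁, b₂) ⊂ n^⊥`, a
`0`-homogeneous real-analytic nine-invariant profile `C` with slit-holomorphic Pick leaf profiles (margin
`δ`) on all nine fans which is the profile of a continuous positive kernel (`K̂ = |k|^{-2a} C` weakly), the
WALL-SINGULAR SET `F = {(w₀, φ) | ¬ jump-free}` obeys the NORMAL-CONE CONDITION for SOME continuous aperture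
`c > 0`: at every `p ∈ F`, every `f` differentiable at `p` with a local maximum on `F` at `p` has
`c(p.1) |∂_φ f| ≤ |∂_{w₀} f|`. Mechanism (card; re-derived by all three triagers): in fan `n`'s holomorphic
coordinates `(ψ, φ)` the wall is the totally real edge `{Re ψ ∈ (π/2)ℤ, Im φ = 0}`; fan `n`'s conic-pencil
cross-theorem thickening (separately holomorphic in `ψ`, jointly real-analytic near `S²`) is, near each wall
point, a pair of OPPOSITE WEDGES over that edge with aperture `c > 0`, so the jump `u = b_{Γ₊}Ĉ - b_{Γ₋}Ĉ`
(hyperfunction boundary values; Pick growth even makes them distributions) has `WF_A(u) ⊂ {|α| ≥ c|β|}`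
(ALPDO I Thm 9.3.3(vi) p.288, 9.3.7 p.291) and `N̄(supp u) ⊂ WF_A(u)` (Thm 8.5.6′ p.253; Prop 8.5.8 p.252
puts the normals of merely differentiable test functions into the closure); `supp u = F` (equal one-sided
boundary values ⇒ holomorphic across, fibrewise Painlevé; the definition of jump-free is locally uniform);
in the coordinate `w₀ = ± cosh 2η` the rapidity aperture `c(η)` becomes `c(η)/(2 sinh 2|η|)`, positive and
continuous on `|w₀| > 1`, and since `F ⊂ {|w₀| ≥ 1 + δ/2}` it extends to a continuous positive `c` on `ℝ`.
With THIS stub alone the sweep S4c clears only cusps of finite `φ`-width `∫^{∞} c` around each seed line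
(pay-off (4a)). Size XL (no `WF_A`/hyperfunction theory in Mathlib: vendor 8.5.6′/9.3.3/9.3.7 as named
Literature facts or prove a two-variable surrogate). -/
theorem stub_wallNormalCone :
    ∀ (a δ : ℝ) (C : E3 → ℝ) (n b₁ b₂ : E3) (F : Set (ℝ × ℝ)), 1/2 ≤ a → a ≤ 1 → 0 < δ →
      n ∈ latticeMirrorNormals (Fin 3) →
      ‖b₁‖ = 1 → ‖b₂‖ = 1 → inner ℝ b₁ b₂ = 0 → inner ℝ b₁ n = 0 → inner ℝ b₂ n = 0 →
      (∀ c : ℝ, 0 < c → ∀ k, C (c • k) = C k) → AnalyticOnNhd ℝ C {0}ᶜ →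
      (∀ n' ∈ latticeMirrorNormals (Fin 3), ∀ k, C (((ℝ ∙ n')ᗮ).reflection k) = C k) →
      (∀ n' ∈ latticeMirrorNormals (Fin 3), ∀ u : E3, inner ℝ u n' = 0 → ‖u‖ = 1 →
        ∃ G : ℂ → ℂ, DifferentiableOn ℂ G {w : ℂ | w.im ≠ 0 ∨ |w.re| < 1 + δ} ∧
          (∀ ψ : ℝ, G (Real.cos (2 * ψ) : ℂ) =
            (C (Real.cos ψ • u + Real.sin ψ • (‖n'‖⁻¹ • n')) : ℂ)) ∧
          (∀ w : ℂ, 0 < w.im → 0 ≤ ((1 + w) ^ (a : ℂ) * G w).im)) →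
      (∃ K : E3 → ℝ, ContinuousOn K {0}ᶜ ∧ (∀ x, x ≠ 0 → 0 < K x) ∧
        ∀ φ : 𝓢(E3, ℂ), ∫ x, (K x : ℂ) * 𝓕 (⇑φ) x =
          ∫ k, ((‖k‖ ^ (-(2 * a)) * C k : ℝ) : ℂ) * φ k) →
      F = {p : ℝ × ℝ | ¬ ∃ ε : ℝ, 0 < ε ∧ ∀ w' φ' : ℝ, |w' - p.1| < ε → |φ' - p.2| < ε →
        ∃ G : ℂ → ℂ, DifferentiableOn ℂ G ({w : ℂ | w.im ≠ 0 ∨ |w.re| < 1} ∪ Metric.ball (w' : ℂ) ε) ∧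
          ∀ ψ : ℝ, G (Real.cos (2 * ψ) : ℂ) =
            (C (Real.cos ψ • (Real.cos φ' • b₁ + Real.sin φ' • b₂) + Real.sin ψ • (‖n‖⁻¹ • n)) : ℂ)} →
      ∃ c : ℝ → ℝ, Continuous c ∧ (∀ w, 0 < c w) ∧
        ∀ p ∈ F, ∀ (f : ℝ × ℝ → ℝ) (f' : ℝ × ℝ →L[ℝ] ℝ), HasFDerivAt f f' p →
          (∀ᶠ q in nhds p, q ∈ F → f q ≤ f p) → c p.1 * |f' (0, 1)| ≤ |f' (1, 0)| := by
  sorry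

/-! ## S4 — the OPEN CORE: a non-integrable aperture (height-uniform aperture in rapidity) -/

/-- **S4 `stub_apertureUpgrade` (HARDEST; the card's pay-off (4b), crux-strength GIVEN the other stubs —
honest: `C⁺_wall ⟺ crux`).** Same data as S4a plus the SEEDS of every oblique partner (S3's output, all
`m`) and SOME aperture (S4a's output): then the normal-cone condition of the wall-singular set `F` holds with
a continuous aperture `c > 0` whose tails are NOT integrable, `∫^{+∞} c = ∫_{-∞} c = ∞`. Why plausibly
true / the bet: fan `n`'s own thickening gives a rapidity aperture decaying like the harmonic measure of a
strip (`c(η) ≍ e^{-2|η|}`, i.e. `c(w₀) ≍ |w₀|^{-2}`, integrable — Siciak's envelope is sharp for a cross,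
triage r1-2/3), so uniformity must come from the OTHER eight fans entering near infinity of `Q_ℂ`: all nine
walls and all leaves accumulate on the null conic `{z·z = 0}` and the large-`|w₀|` problem is asymptotically
DILATION COVARIANT; an exterior normal `(α, β)` at height `w₀` transported to `λw₀` is `(α/λ, β)`, so a
dilation-covariant aperture is `c(w₀) ≍ c₀/|w₀|` — height-uniform in rapidity and EXACTLY log-divergent,
which is all S4c needs. Why it might fail: a transcendental "compatible complex curve" in `Q_ℂ` (algebraic
ones are excluded — card degree 1, cdisprove genus count for all degrees) meeting each fan only inside its
own walls would cap the line at (4a); Disproof F12's `V_R ≠ ℝ` would produce a polar-side `F` with integrable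
aperture. MONOTONE: every wall patch cleared is a new seed. Size XL / open. -/
theorem stub_apertureUpgrade :
    ∀ (a δ : ℝ) (C : E3 → ℝ) (n b₁ b₂ : E3) (F : Set (ℝ × ℝ)), 1/2 ≤ a → a ≤ 1 → 0 < δ →
      n ∈ latticeMirrorNormals (Fin 3) →
      ‖b₁‖ = 1 → ‖b₂‖ = 1 → inner ℝ b₁ b₂ = 0 → inner ℝ b₁ n = 0 → inner ℝ b₂ n = 0 →
      (∀ c : ℝ, 0 < c → ∀ k, C (c • k) = C k) → AnalyticOnNhd ℝ C {0}ᶜ →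
      (∀ n' ∈ latticeMirrorNormals (Fin 3), ∀ k, C (((ℝ ∙ n')ᗮ).reflection k) = C k) →
      (∀ n' ∈ latticeMirrorNormals (Fin 3), ∀ u : E3, inner ℝ u n' = 0 → ‖u‖ = 1 →
        ∃ G : ℂ → ℂ, DifferentiableOn ℂ G {w : ℂ | w.im ≠ 0 ∨ |w.re| < 1 + δ} ∧
          (∀ ψ : ℝ, G (Real.cos (2 * ψ) : ℂ) =
            (C (Real.cos ψ • u + Real.sin ψ • (‖n'‖⁻¹ • n')) : ℂ)) ∧
          (∀ w : ℂ, 0 < w.im → 0 ≤ ((1 + w) ^ (a : ℂ) * G w).im)) →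
      (∃ K : E3 → ℝ, ContinuousOn K {0}ᶜ ∧ (∀ x, x ≠ 0 → 0 < K x) ∧
        ∀ φ : 𝓢(E3, ℂ), ∫ x, (K x : ℂ) * 𝓕 (⇑φ) x =
          ∫ k, ((‖k‖ ^ (-(2 * a)) * C k : ℝ) : ℂ) * φ k) →
      (∀ m ∈ latticeMirrorNormals (Fin 3), inner ℝ n m ≠ 0 → inner ℝ n m ^ 2 ≠ ‖n‖ ^ 2 * ‖m‖ ^ 2 →
        ∀ φ₀ : ℝ, Real.cos φ₀ • b₁ + Real.sin φ₀ • b₂ =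
          ‖m - (inner ℝ m n / ‖n‖ ^ 2) • n‖⁻¹ • (m - (inner ℝ m n / ‖n‖ ^ 2) • n) →
        ∀ w₀ : ℝ, ∃ ε : ℝ, 0 < ε ∧ ∀ w' φ' : ℝ, |w' - w₀| < ε → |φ' - φ₀| < ε →
          ∃ G : ℂ → ℂ, DifferentiableOn ℂ G ({w : ℂ | w.im ≠ 0 ∨ |w.re| < 1} ∪ Metric.ball (w' : ℂ) ε) ∧
            ∀ ψ : ℝ, G (Real.cos (2 * ψ) : ℂ) =
              (C (Real.cos ψ • (Real.cos φ' • b₁ + Real.sin φ' • b₂) + Real.sin ψ • (‖n‖⁻¹ • n)) : ℂ)) →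
      F = {p : ℝ × ℝ | ¬ ∃ ε : ℝ, 0 < ε ∧ ∀ w' φ' : ℝ, |w' - p.1| < ε → |φ' - p.2| < ε →
        ∃ G : ℂ → ℂ, DifferentiableOn ℂ G ({w : ℂ | w.im ≠ 0 ∨ |w.re| < 1} ∪ Metric.ball (w' : ℂ) ε) ∧
          ∀ ψ : ℝ, G (Real.cos (2 * ψ) : ℂ) =
            (C (Real.cos ψ • (Real.cos φ' • b₁ + Real.sin φ' • b₂) + Real.sin ψ • (‖n‖⁻¹ • n)) : ℂ)} →
      (∃ c : ℝ → ℝ, Continuous c ∧ (∀ w, 0 < c w) ∧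
        ∀ p ∈ F, ∀ (f : ℝ × ℝ → ℝ) (f' : ℝ × ℝ →L[ℝ] ℝ), HasFDerivAt f f' p →
          (∀ᶠ q in nhds p, q ∈ F → f q ≤ f p) → c p.1 * |f' (0, 1)| ≤ |f' (1, 0)|) →
      ∃ c : ℝ → ℝ, Continuous c ∧ (∀ w, 0 < c w) ∧
        (∀ w₁ : ℝ, ¬ IntegrableOn c (Set.Ioi w₁)) ∧ (∀ w₁ : ℝ, ¬ IntegrableOn c (Set.Iio w₁)) ∧
        ∀ p ∈ F, ∀ (f : ℝ × ℝ → ℝ) (f' : ℝ × ℝ →L[ℝ] ℝ), HasFDerivAt f f' p →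
          (∀ᶠ q in nhds p, q ∈ F → f q ≤ f p) → c p.1 * |f' (0, 1)| ≤ |f' (1, 0)| := by
  sorry

/-! ## S4c — John's global Holmgren sweep in the wall geometry (elementary) -/

/-- **S4c `stub_holmgrenJohnSweep`** (the sweep; F. John's global Holmgren argument, here plane geometry +
one-variable calculus). A CLOSED set `F ⊂ ℝ × ℝ`, `2π`-periodic in the second coordinate, lying in
`{|w₀| > w₁}` (`w₁ ≥ 0`), which misses one vertical line `{φ = φ₀}` and obeys the normal-cone condition for a
continuous aperture `c > 0` with NON-INTEGRABLE tails, is empty. Proof sketch: on the tail `w₀ > w₁` put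
`Q(w₀) = ∫_{w₁}^{w₀} c` (`→ ∞` by non-integrability), fix `0 < s < 1` and minimise
`q = (φ - φ₀) + s Q(w₀)` over `F ∩ {w₀ ≥ w₁} ∩ {φ₀ ≤ φ ≤ φ₀ + 2π}` (closed; sublevel sets compact because
`Q → ∞`); a minimiser `p̂` is off the two bounding seed lines (periodicity) and has `ŵ > w₁`, so `-q` has a
local maximum ON `F` at `p̂` with derivative `(-s c(ŵ), -1)` (FTC, `c` continuous), and the normal-cone
condition gives `c(ŵ) ≤ s c(ŵ)` — contradiction; the tail `w₀ < -w₁` symmetrically with `∫_{w₀}^{-w₁} c`.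
The level curves of `q` are the card's non-characteristic sweep curves (slope `|dφ/dw₀| = s c < c`).
Size M (`IsCompact.exists_isMinOn`, `intervalIntegral.integral_hasDerivAt_right`, non-integrable
non-negative ⇒ `∫_{w₁}^{R} c → ∞`). -/
theorem stub_holmgrenJohnSweep :
    ∀ (F : Set (ℝ × ℝ)) (c : ℝ → ℝ) (w₁ φ₀ : ℝ), IsClosed F → 0 ≤ w₁ →
      (∀ p ∈ F, w₁ < |p.1|) →
      (∀ p : ℝ × ℝ, p ∈ F ↔ (p.1, p.2 + 2 * Real.pi) ∈ F) →
      (∀ w : ℝ, (w, φ₀) ∉ F) →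
      Continuous c → (∀ w, 0 < c w) →
      (∀ w : ℝ, ¬ IntegrableOn c (Set.Ioi w)) → (∀ w : ℝ, ¬ IntegrableOn c (Set.Iio w)) →
      (∀ p ∈ F, ∀ (f : ℝ × ℝ → ℝ) (f' : ℝ × ℝ →L[ℝ] ℝ), HasFDerivAt f f' p →
        (∀ᶠ q in nhds p, q ∈ F → f q ≤ f p) → c p.1 * |f' (0, 1)| ≤ |f' (1, 0)|) →
      F = ∅ := by
  sorry

/-! ## S5 — TRANSFER: a jump-free fan is constant (patching + Pick growth + Liouville; leaves cover `S²`) -/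

/-- **S5 `stub_jumpFreeFanConstant`** (the card's `Transfer`, `C⁺_wall(n) ⇒ crux`, for ONE fan). Let
`0 < a ≤ 1`, `n ≠ 0` with an orthonormal pair `(b₁, b₂) ⊂ n^⊥`, `C` `0`-homogeneous, every leaf of fan `n`
carrying a slit-holomorphic profile with `(1+w)^a G` Pick, and suppose EVERY wall coordinate `(w₀, φ)` is
jump-free. Then `C k = C n` for all `k ≠ 0`. Why true: `(b₁, b₂, n̂)` is an orthonormal basis (`dim = 3`), so
every unit `u ⊥ n` is `cos φ b₁ + sin φ b₂`; jump-freeness at every `(w₀, φ)` gives continuations across every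
real point which patch (identity theorem on the connected cut plane `{Im ≠ 0} ∪ {|Re| < 1}`, agreement of
any two leaf profiles on `(-1,1)`) to an ENTIRE `G` with `(1+w)^a G` Pick; Pick ⇒
`|(1+w)^a G(w)| ≤ A(1+|w|²)/Im w`; `G` real on `[-1,1]` ⇒ `G(w̄) = conj (G w)`; Poisson–Jensen on `|w| = R`
(`log(1/|sin θ|)` integrable) ⇒ polynomial growth ⇒ `G` polynomial (Cauchy estimates); `F(iy) = O(y)` ⇒
`deg G + a ≤ 1` ⇒ `G` constant `= G(-1) = C(n̂) = C(n)`; every `k ≠ 0` has `k/‖k‖` on a leaf of fan `n`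
(Disproof F2's Nevanlinna-growth form of the 7-circle lemma, uniform in `a ∈ (0,1]`). Size M–L (Pick
growth bound, "polynomial growth ⇒ polynomial" and the patching are not in Mathlib as such;
`Differentiable.apply_eq_apply_of_bounded`, `Complex.norm_deriv_le_of_forall_mem_sphere_norm_le`,
`AnalyticOnNhd.eqOn_of_preconnected_of_frequently_eq` are). -/
theorem stub_jumpFreeFanConstant :
    ∀ (a δ : ℝ) (C : E3 → ℝ) (n b₁ b₂ : E3), 0 < a → a ≤ 1 → 0 < δ → n ≠ 0 →
      ‖b₁‖ = 1 → ‖b₂‖ = 1 → inner ℝ b₁ b₂ = 0 → inner ℝ b₁ n = 0 → inner ℝ b₂ n = 0 →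
      (∀ c : ℝ, 0 < c → ∀ k, C (c • k) = C k) →
      (∀ u : E3, inner ℝ u n = 0 → ‖u‖ = 1 → ∃ G : ℂ → ℂ,
        DifferentiableOn ℂ G {w : ℂ | w.im ≠ 0 ∨ |w.re| < 1 + δ} ∧
        (∀ ψ : ℝ, G (Real.cos (2 * ψ) : ℂ) = (C (Real.cos ψ • u + Real.sin ψ • (‖n‖⁻¹ • n)) : ℂ)) ∧
        (∀ w : ℂ, 0 < w.im → 0 ≤ ((1 + w) ^ (a : ℂ) * G w).im)) →
      (∀ w₀ φ : ℝ, ∃ ε : ℝ, 0 < ε ∧ ∀ w' φ' : ℝ, |w' - w₀| < ε → |φ' - φ| < ε →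
        ∃ G : ℂ → ℂ, DifferentiableOn ℂ G ({w : ℂ | w.im ≠ 0 ∨ |w.re| < 1} ∪ Metric.ball (w' : ℂ) ε) ∧
          ∀ ψ : ℝ, G (Real.cos (2 * ψ) : ℂ) =
            (C (Real.cos ψ • (Real.cos φ' • b₁ + Real.sin φ' • b₂) + Real.sin ψ • (‖n‖⁻¹ • n)) : ℂ)) →
      ∀ k : E3, k ≠ 0 → C k = C n := by
  sorry

/-! ## Proved glue (not stubs): the wall-singular set is closed, `2π`-periodic and off the band `|w₀| ≤ 1` -/

/-- The WALL-SINGULAR SET of fan `n` in the basis `(b₁, b₂)`: wall coordinates `(w₀, φ)` that are NOT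
jump-free — literally the set the composition passes for `F` in S4a/S4 (a `Set`-valued abbreviation used
only by the glue below; every stub inlines it). -/
def wallSingularSet (C : E3 → ℝ) (n b₁ b₂ : E3) : Set (ℝ × ℝ) :=
  {p : ℝ × ℝ | ¬ ∃ ε : ℝ, 0 < ε ∧ ∀ w' φ' : ℝ, |w' - p.1| < ε → |φ' - p.2| < ε →
    ∃ G : ℂ → ℂ, DifferentiableOn ℂ G ({w : ℂ | w.im ≠ 0 ∨ |w.re| < 1} ∪ Metric.ball (w' : ℂ) ε) ∧
      ∀ ψ : ℝ, G (Real.cos (2 * ψ) : ℂ) =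
        (C (Real.cos ψ • (Real.cos φ' • b₁ + Real.sin φ' • b₂) + Real.sin ψ • (‖n‖⁻¹ • n)) : ℂ)}

/-- Periodicity of the wall-singular set in the form the sweep consumes. [folklore] -/
theorem mem_wallSingularSet_iff_add_two_pi (C : E3 → ℝ) (n b₁ b₂ : E3) (p : ℝ × ℝ) :
    p ∈ wallSingularSet C n b₁ b₂ ↔ (p.1, p.2 + 2 * Real.pi) ∈ wallSingularSet C n b₁ b₂ := by
  simp only [wallSingularSet, Set.mem_setOf_eq]
  refine not_congr ⟨?_, ?_⟩
  · rintro ⟨ε, hε, h⟩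
    refine ⟨ε, hε, fun w' φ' hw hφ => ?_⟩
    obtain ⟨G, hG, hL⟩ := h w' (φ' - 2 * Real.pi) hw (by
      have : φ' - 2 * Real.pi - p.2 = φ' - (p.2 + 2 * Real.pi) := by ring
      rw [this]; exact hφ)
    refine ⟨G, hG, fun ψ => ?_⟩
    rw [hL ψ, Real.cos_sub_two_pi, Real.sin_sub_two_pi]
  · rintro ⟨ε, hε, h⟩
    refine ⟨ε, hε, fun w' φ' hw hφ => ?_⟩
    obtain ⟨G, hG, hL⟩ := h w' (φ' + 2 * Real.pi) hw (by
      have : φ' + 2 * Real.pi - (p.2 + 2 * Real.pi) = φ' - p.2 := by ring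
      rw [this]; exact hφ)
    refine ⟨G, hG, fun ψ => ?_⟩
    rw [hL ψ, Real.cos_add_two_pi, Real.sin_add_two_pi]

/-- The jump-free locus is open (the definition is locally uniform), so the wall-singular set is closed.
[folklore] -/
theorem isClosed_wallSingularSet (C : E3 → ℝ) (n b₁ b₂ : E3) :
    IsClosed (wallSingularSet C n b₁ b₂) := by
  rw [← isOpen_compl_iff]
  rw [Metric.isOpen_iff]
  intro p hp
  simp only [wallSingularSet, Set.mem_compl_iff, Set.mem_setOf_eq, not_not] at hp
  obtain ⟨ε, hε, h⟩ := hp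
  refine ⟨ε / 2, by positivity, fun q hq => ?_⟩
  rw [Metric.mem_ball, Prod.dist_eq, max_lt_iff, Real.dist_eq, Real.dist_eq] at hq
  simp only [wallSingularSet, Set.mem_compl_iff, Set.mem_setOf_eq, not_not]
  refine ⟨ε / 2, by positivity, fun w' φ' hw hφ => ?_⟩
  have hw' : |w' - p.1| < ε := by
    have h1 := abs_sub_lt_iff.1 hw; have h2 := abs_sub_lt_iff.1 hq.1
    rw [abs_sub_lt_iff]; constructor <;> linarith
  have hφ' : |φ' - p.2| < ε := by
    have h1 := abs_sub_lt_iff.1 hφ; have h2 := abs_sub_lt_iff.1 hq.2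
    rw [abs_sub_lt_iff]; constructor <;> linarith
  obtain ⟨G, hG, hL⟩ := h w' φ' hw' hφ'
  refine ⟨G, hG.mono ?_, hL⟩
  exact Set.union_subset_union_right _ (Metric.ball_subset_ball (by linarith))

/-- A point on the circle of an orthonormal pair is a unit vector. [folklore] -/
theorem norm_cos_smul_add_sin_smul {b₁ b₂ : E3} (h1 : ‖b₁‖ = 1) (h2 : ‖b₂‖ = 1)
    (h12 : inner ℝ b₁ b₂ = 0) (φ : ℝ) : ‖Real.cos φ • b₁ + Real.sin φ • b₂‖ = 1 := by
  have hsq : ‖Real.cos φ • b₁ + Real.sin φ • b₂‖ ^ 2 = 1 := by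
    rw [norm_add_sq_real, norm_smul, norm_smul, real_inner_smul_left, real_inner_smul_right, h12, h1, h2,
      Real.norm_eq_abs, Real.norm_eq_abs]
    nlinarith [Real.cos_sq_add_sin_sq φ, sq_abs (Real.cos φ), sq_abs (Real.sin φ)]
  exact (pow_eq_one_iff_of_nonneg (norm_nonneg _) two_ne_zero).1 hsq

/-- A point on the circle of a pair orthogonal to `n` is orthogonal to `n`. [folklore] -/
theorem inner_cos_smul_add_sin_smul {b₁ b₂ n : E3} (h1 : inner ℝ b₁ n = 0) (h2 : inner ℝ b₂ n = 0)
    (φ : ℝ) : inner ℝ (Real.cos φ • b₁ + Real.sin φ • b₂) n = 0 := by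
  rw [inner_add_left, real_inner_smul_left, real_inner_smul_left, h1, h2]
  ring

/-- Inside the slit margin every wall coordinate is jump-free: `F ⊂ {|w₀| > 1}`. [folklore] -/
theorem not_mem_wallSingularSet_of_abs_le_one {C : E3 → ℝ} {n b₁ b₂ : E3} {δ : ℝ} (hδ : 0 < δ)
    (h1 : ‖b₁‖ = 1) (h2 : ‖b₂‖ = 1) (h12 : inner ℝ b₁ b₂ = 0)
    (h1n : inner ℝ b₁ n = 0) (h2n : inner ℝ b₂ n = 0)
    (hleaf : ∀ u : E3, inner ℝ u n = 0 → ‖u‖ = 1 → ∃ G : ℂ → ℂ,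
      DifferentiableOn ℂ G {w : ℂ | w.im ≠ 0 ∨ |w.re| < 1 + δ} ∧
      ∀ ψ : ℝ, G (Real.cos (2 * ψ) : ℂ) = (C (Real.cos ψ • u + Real.sin ψ • (‖n‖⁻¹ • n)) : ℂ))
    {p : ℝ × ℝ} (hp : |p.1| ≤ 1) : p ∉ wallSingularSet C n b₁ b₂ := by
  simp only [wallSingularSet, Set.mem_setOf_eq, not_not]
  refine ⟨δ / 2, by positivity, fun w' φ' hw hφ => ?_⟩
  obtain ⟨G, hG, hL⟩ := hleaf (Real.cos φ' • b₁ + Real.sin φ' • b₂)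
    (inner_cos_smul_add_sin_smul h1n h2n φ') (norm_cos_smul_add_sin_smul h1 h2 h12 φ')
  refine ⟨G, hG.mono ?_, hL⟩
  rintro w (hw1 | hw2)
  · rcases hw1 with h | h
    · exact Or.inl h
    · exact Or.inr (by linarith)
  · right
    rw [Metric.mem_ball, Complex.dist_eq] at hw2
    have hre : |w.re - w'| < δ / 2 := by
      have := Complex.abs_re_le_norm (w - (w' : ℂ))
      simp only [Complex.sub_re, Complex.ofReal_re] at this
      linarith
    have ha := abs_sub_lt_iff.1 hre
    have hb := abs_sub_lt_iff.1 hw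
    have hc := abs_le.1 hp
    rw [abs_lt]; constructor <;> linarith

/-! ## Concrete facts about `e₁, e₂, e₃` and the seed partner `e₁ + e₃` -/

/-- `e_i` (reducible). -/
abbrev ee (i : Fin 3) : E3 := EuclideanSpace.single i (1 : ℝ)

theorem norm_ee (i : Fin 3) : ‖ee i‖ = 1 := by
  simp [ee]

theorem inner_ee (i j : Fin 3) : inner ℝ (ee i) (ee j) = if i = j then (1 : ℝ) else 0 := by
  simp [ee, EuclideanSpace.inner_single_left, PiLp.single_apply]

theorem e3_mem_latticeMirrorNormals : ee 2 ∈ latticeMirrorNormals (Fin 3) :=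
  single_mem_latticeMirrorNormals (i := 2) (j := 0) (by decide)

theorem e1_add_e3_mem_latticeMirrorNormals : ee 0 + ee 2 ∈ latticeMirrorNormals (Fin 3) :=
  single_add_single_mem_latticeMirrorNormals (i := 0) (j := 2) (by decide)

theorem inner_e3_e1_add_e3 : inner ℝ (ee 2) (ee 0 + ee 2) = 1 := by
  rw [inner_add_right, inner_ee, inner_ee]; simp

theorem norm_sq_e1_add_e3 : ‖ee 0 + ee 2‖ ^ 2 = 2 := by
  rw [norm_add_sq_real, inner_ee, norm_ee, norm_ee]; simp; norm_num

/-- The bi-polar direction of `(e₃, e₁ + e₃)` is `e₁ = cos 0 • e₁ + sin 0 • e₂`. [folklore] -/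
theorem seedDirection_e3 :
    Real.cos 0 • ee 0 + Real.sin 0 • ee 1 =
      ‖(ee 0 + ee 2) - (inner ℝ (ee 0 + ee 2) (ee 2) / ‖ee 2‖ ^ 2) • ee 2‖⁻¹ •
        ((ee 0 + ee 2) - (inner ℝ (ee 0 + ee 2) (ee 2) / ‖ee 2‖ ^ 2) • ee 2) := by
  have hin : inner ℝ (ee 0 + ee 2) (ee 2) = 1 := by
    rw [real_inner_comm]; exact inner_e3_e1_add_e3
  have hsub : ee 0 + ee 2 - (inner ℝ (ee 0 + ee 2) (ee 2) / ‖ee 2‖ ^ 2) • ee 2 = ee 0 := by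
    rw [hin, norm_ee]; simp
  rw [hsub, norm_ee, Real.cos_zero, Real.sin_zero]
  simp

/-! ## The composition: the seven stubs give the crux BY NAME -/

/-- **`HRP2Rigidity` from the line `wall-jump-edge-of-the-wedge`** (kernel-checked, no `sorry` of its own).
Given the crux hypotheses: `K` is even (three coordinate mirrors — the landed
`Negative.even_of_coordinate_mirrors`), so S1 applies to each of the nine normals (RP enters here, nine
times); S2 gives the analytic profile `C` with a uniform slit margin `δ`, Pick leaf profiles on all nine
fans, the weak identity `K̂ = |k|^{-2a}C` and the symmetry transfer; S3 gives the seeds of every oblique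
partner of `e₃`, in particular the whole line `φ = 0` (partner `e₁ + e₃`, bi-polar direction `e₁`); S4a and
S4 give an aperture with non-integrable tails for the normal cone of the wall-singular set `F` of fan `e₃`;
`F` is closed, `2π`-periodic and contained in `{|w₀| > 1}` (proved above), so the sweep S4c empties it; S5
makes `C` constant off `0`; a constant profile is invariant under every linear isometry `R`, and the transfer
clause of S2 gives `K (R x) = K x`. -/
theorem HRP2Rigidity_of : HRP2Rigidity := by
  intro Δ K hΔ1 hΔ2 hcont hpos hhom hnine R x
  -- the nine invariances and reflection positivities, in Literature vocabulary
  have hinv : ∀ n ∈ latticeMirrorNormals (Fin 3), ∀ y, K (((ℝ ∙ n)ᗮ).reflection y) = K y :=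
    fun n hn => (hnine n ((mem_latticeMirrorNormals_iff n).1 hn)).1
  have hRP : ∀ n ∈ latticeMirrorNormals (Fin 3), IsMirrorRPKernel n K :=
    fun n hn => (hnine n ((mem_latticeMirrorNormals_iff n).1 hn)).2
  -- evenness from the three coordinate mirrors (landed Negative lemma)
  have heven : ∀ y, K (-y) = K y :=
    Theorems.HRP2Rigidity.Negative.even_of_coordinate_mirrors (fun n hn => (hnine n hn).1)
  -- S1: the Laplace–Fourier representation for each of the nine normals (RP consumed here)
  have hlap : ∀ n ∈ latticeMirrorNormals (Fin 3), ∃ μ : Measure (ℝ × E3),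
      (∀ᵐ p ∂μ, 0 ≤ p.1 ∧ inner ℝ p.2 n = 0) ∧
      ∀ x : E3, 0 < inner ℝ x n →
        Integrable (fun p : ℝ × E3 => Real.exp (-(p.1 * (inner ℝ x n / ‖n‖)))) μ ∧
        K x = ∫ p, Real.exp (-(p.1 * (inner ℝ x n / ‖n‖))) * Real.cos (inner ℝ p.2 x) ∂μ :=
    fun n hn => stub_laplaceRepresentation Δ K n (by linarith) (ne_zero_of_mem_latticeMirrorNormals hn)
      hcont hhom heven (hinv n hn) (hRP n hn)
  -- S2: the analytic profile with a uniform slit margin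
  obtain ⟨C, hC0, hCan, hCinv, ⟨δ, hδ, hPick⟩, hCker, hCtransfer⟩ :=
    stub_analyticProfile Δ K hΔ1 hΔ2 hcont hpos hhom hinv hlap
  -- the window in the variable `a = 3/2 - Δ`
  have ha1 : 1/2 ≤ (3:ℝ)/2 - Δ := by linarith
  have ha2 : (3:ℝ)/2 - Δ ≤ 1 := by linarith
  have ha0 : 0 < (3:ℝ)/2 - Δ := by linarith
  have hker : ∃ K : E3 → ℝ, ContinuousOn K {0}ᶜ ∧ (∀ x, x ≠ 0 → 0 < K x) ∧
      ∀ φ : 𝓢(E3, ℂ), ∫ x, (K x : ℂ) * 𝓕 (⇑φ) x =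
        ∫ k, ((‖k‖ ^ (-(2 * ((3:ℝ)/2 - Δ))) * C k : ℝ) : ℂ) * φ k := ⟨K, hcont, hpos, hCker⟩
  -- the fan `e₃` with the basis `(e₁, e₂)` of its equatorial plane
  have he₃ : ee 2 ∈ latticeMirrorNormals (Fin 3) := e3_mem_latticeMirrorNormals
  have hb1 : ‖ee 0‖ = 1 := norm_ee 0
  have hb2 : ‖ee 1‖ = 1 := norm_ee 1
  have hb12 : inner ℝ (ee 0) (ee 1) = 0 := by rw [inner_ee]; simp
  have hb1n : inner ℝ (ee 0) (ee 2) = 0 := by rw [inner_ee]; simp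
  have hb2n : inner ℝ (ee 1) (ee 2) = 0 := by rw [inner_ee]; simp
  -- slit-holomorphic leaf profiles (Pick dropped) for any lattice fan
  have hslit : ∀ n' ∈ latticeMirrorNormals (Fin 3), ∀ u : E3, inner ℝ u n' = 0 → ‖u‖ = 1 →
      ∃ G : ℂ → ℂ, DifferentiableOn ℂ G {w : ℂ | w.im ≠ 0 ∨ |w.re| < 1 + δ} ∧
        ∀ ψ : ℝ, G (Real.cos (2 * ψ) : ℂ) = (C (Real.cos ψ • u + Real.sin ψ • (‖n'‖⁻¹ • n')) : ℂ) := by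
    intro n' hn' u hu hu1
    obtain ⟨G, hG, hL, -⟩ := hPick n' hn' u hu hu1
    exact ⟨G, hG, hL⟩
  -- S3: the whole vertical wall line `φ = 0` of fan `e₃` is jump-free (partner `e₁ + e₃`, direction `e₁`)
  have hob : inner ℝ (ee 2) (ee 0 + ee 2) ≠ 0 := by rw [inner_e3_e1_add_e3]; norm_num
  have hnp : inner ℝ (ee 2) (ee 0 + ee 2) ^ 2 ≠ ‖ee 2‖ ^ 2 * ‖ee 0 + ee 2‖ ^ 2 := by
    rw [inner_e3_e1_add_e3, norm_ee, norm_sq_e1_add_e3]; norm_num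
  have hline : ∀ w : ℝ, (w, (0:ℝ)) ∉ wallSingularSet C (ee 2) (ee 0) (ee 1) := by
    intro w hw
    exact hw (stub_bipolarSeeds C (ee 2) (ee 0 + ee 2) (ee 0) (ee 1) δ 0 he₃
      e1_add_e3_mem_latticeMirrorNormals hob hnp hb1 hb2 hb12 hb1n hb2n hC0 hCan hδ (hslit (ee 2) he₃)
      (hslit (ee 0 + ee 2) e1_add_e3_mem_latticeMirrorNormals) seedDirection_e3 w)
  -- S4a: some aperture for the normal cone of the wall-singular set `F` of fan `e₃`
  obtain ⟨c₀, hc₀⟩ := stub_wallNormalCone ((3:ℝ)/2 - Δ) δ C (ee 2) (ee 0) (ee 1)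
    (wallSingularSet C (ee 2) (ee 0) (ee 1)) ha1 ha2 hδ he₃ hb1 hb2 hb12 hb1n hb2n hC0 hCan hCinv hPick hker rfl
  -- S4: an aperture with non-integrable tails (the seeds of EVERY oblique partner are fed in, via S3)
  obtain ⟨c, hc, hcpos, hIoi, hIio, hcone⟩ := stub_apertureUpgrade ((3:ℝ)/2 - Δ) δ C (ee 2) (ee 0) (ee 1)
    (wallSingularSet C (ee 2) (ee 0) (ee 1)) ha1 ha2 hδ he₃ hb1 hb2 hb12 hb1n hb2n hC0 hCan hCinv hPick hker
    (fun m hm hob' hnp' φ₀ hφ₀ w₀ => stub_bipolarSeeds C (ee 2) m (ee 0) (ee 1) δ φ₀ he₃ hm hob' hnp' hb1 hb2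
      hb12 hb1n hb2n hC0 hCan hδ (hslit (ee 2) he₃) (hslit m hm) hφ₀ w₀)
    rfl ⟨c₀, hc₀⟩
  -- the wall-singular set lies off the band `|w₀| ≤ 1`
  have hband : ∀ p ∈ wallSingularSet C (ee 2) (ee 0) (ee 1), (1:ℝ) < |p.1| := by
    intro p hp
    by_contra hle
    exact not_mem_wallSingularSet_of_abs_le_one hδ hb1 hb2 hb12 hb1n hb2n (hslit (ee 2) he₃)
      (not_lt.1 hle) hp
  -- S4c: the sweep empties it
  have hF : wallSingularSet C (ee 2) (ee 0) (ee 1) = ∅ :=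
    stub_holmgrenJohnSweep (wallSingularSet C (ee 2) (ee 0) (ee 1)) c 1 0
      (isClosed_wallSingularSet C (ee 2) (ee 0) (ee 1)) zero_le_one hband
      (mem_wallSingularSet_iff_add_two_pi C (ee 2) (ee 0) (ee 1)) hline hc hcpos hIoi hIio hcone
  -- S5: a jump-free fan is constant
  have hconst : ∀ k : E3, k ≠ 0 → C k = C (ee 2) :=
    stub_jumpFreeFanConstant ((3:ℝ)/2 - Δ) δ C (ee 2) (ee 0) (ee 1) ha0 ha2 hδ
      (ne_zero_of_mem_latticeMirrorNormals he₃) hb1 hb2 hb12 hb1n hb2n hC0 (hPick (ee 2) he₃) (by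
        intro w₀ φ
        by_contra h
        have hmem : (w₀, φ) ∈ wallSingularSet C (ee 2) (ee 0) (ee 1) := h
        rw [hF] at hmem
        exact hmem)
  -- a constant profile is invariant under every linear isometry
  have hCR : ∀ k, C (R k) = C k := by
    intro k
    by_cases hk : k = 0
    · subst hk; simp
    · rw [hconst k hk, hconst (R k) (by simpa using hk)]
  -- transfer to `K`
  exact hCtransfer R hCR x

end Summit.CriticalPhenomena.Ising3DConformalLimit.Cruxes.HRP2Rigidity.WallJumpEdgeOfTheWedge

end
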